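import Summits.ResolutionOfSingularities.ResolutionOfSingularities.Theorems.FrobeniusLadderFInjectiveMacaulayficationSigma3P2d4F5Specimen
import Summits.ResolutionOfSingularities.ResolutionOfSingularities.Theorems.FrobeniusLadderFInjectiveMacaulayficationB9PointFloorNotFull
import HarnessLib

/-!
# `f′ = σ₃(f_P2d4F5) = z² + x²z + x⁵ + x⁶ + y⁵ + u⁵ + t⁵` (char 2): the POINT FLOOR is a LEGAL input and NOT FULL — the input side of the two-sided row
# (crux `FInjectiveMacaulayfication` stmt-ResolutionOfSingularities-15315, chain w45a; (W-WND) class-route COVERAGE PROGRAMME, res-L1-w45a-plan-1 RULING R22.14 (2); seat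
# res-L1-w45a-stub-2 g11; templates = this seatʼs pilot ✓ p681046 `Sigma5P2d4CPointFloor`, res-L1-w45a-stub-1 g13ʼs `B9PointFloorNotFull` (engines ✓ `PointFloorLegalOfIsolated`, ✓ `PointFloorNotFullOfFedder`) and res-L1-w45a-stub-3
# g11ʼs `FDSpecimen` §2; consumed with the class-route cure by `Sigma3P2d4F5PointFloorRowClass`, then transported to P2d4F5 by res-L1-w45a-stub-1ʼs
# `PolyAutRowTransport.pointFloorRow_of_algEquiv`)

[OURS · L1 W4.5a] Support file (`--supports stmt-ResolutionOfSingularities-15315 --as helper`); def-free, unconditional; replaces the role of NO printed item; NOT a statement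
of the manuscript; AI-written (AI review is weaker than expert review).

`X = Spec (k[X₀..X₄]/(f′))`, `f′ = X4 ^ 2 + X0 ^ 2 * X4 + X0 ^ 5 + X0 ^ 6 + X1 ^ 5 + X2 ^ 5 + X3 ^ 5` (`(x,y,u,t,z) = (X 0,…,X 4)`), `char k = 2` (any field), `v` = the vertex.
* §0 vertex binders (FDSpecimen §2 verbatim on the `Sigma3P2d4F5Specimen` derivative table): `isClosed_vertex`, `vertex_not_mem_regularLocus` (`f′(0) = 0`, `∇f′(0) = 0`),
  `ringKrullDim_stalk_vertex = 4`, `regular_of_ne_vertex` (ISOLATED), `regular_off_closedPoint_vertex`, `cmCl_Spec_stalk_vertex`;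
* §1 the strict transforms of the point blow-up: `theta` (`θᵢ f′ = Xᵢ² · gᵢ`, `g_x = z² + xz + x³ + x⁴ + x³(y⁵+u⁵+t⁵)`, `g_y = z² + x²yz + x⁵y³ + x⁶y⁴ + y³(1+u⁵+t⁵)`, …),
  `g_not_mem_span_X`, `constantCoeff_g_one`, `g_one_mem_frobeniusPower` (`g_y ∈ (x²,y²,u²,t²,z²)` termwise — the Fedder certificate at the origin of the `y`-chart; the `x`-chart origin is F-pure);
* §2 ★ `pointFloor_sigma3F5_input_legal` — for EVERY blowing up `g : S′ → Spec 𝒪_{X,v}` along the point floor: `I ≠ ⊥`, `Supp I ⊆ (Reg)ᶜ`, `S′` regular off the closed fibre, CM;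
* §3 ★ `pointFloor_sigma3F5_not_full` — … there is a point of `S′` over the closed point that is NOT `FullCl 2` (so the floor is NOT an F(4)-isomorphism and a cure is needed).
[folklore; cite: Fedder1983, Prop. 1.7 and Thm. 1.12] [cite: GortzWedhorn2020, Prop. 13.91] [cite: Hartshorne1977, I Thm. 5.1] [cite: Temkin2008, §2.1]
-/

-- single-problem summit: the doubled namespace component is forced
set_option linter.dupNamespace false

noncomputable section

namespace Summit.ResolutionOfSingularities.ResolutionOfSingularities.Theorems.FInjectiveMacaulayfication.Sigma3P2d4F5PointFloor

open CategoryTheory CategoryTheory.Limits AlgebraicGeometry TopologicalSpace IsLocalRing MvPolynomial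
open Literature.AlgebraicGeometry.Resolution
open Summit.ResolutionOfSingularities.ResolutionOfSingularities.Theorems.FInjectiveMacaulayfication
open SliceableCentre GermForm GermOfGlobalBlowup

variable (k : Type) [Field k]

/-! ## §0 The binders at the vertex -/

/-- (H1) the vertex is closed. [folklore] -/
theorem isClosed_vertex (f : MvPolynomial (Fin 5) k) (hf : f = X 4 ^ 2 + X 0 ^ 2 * X 4 + X 0 ^ 5 + X 0 ^ 6 + X 1 ^ 5 + X 2 ^ 5 + X 3 ^ 5)
    (v : Spec (.of (MvPolynomial (Fin 5) k ⧸ Ideal.span {f})))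
    (hv : v.asIdeal = Ideal.span (Set.range fun j : Fin 5 => Ideal.Quotient.mk (Ideal.span {f}) (X j))) :
    IsClosed ({v} : Set (Spec (.of (MvPolynomial (Fin 5) k ⧸ Ideal.span {f})))) :=
  DoublePointFermatCubicGerm.isClosed_origin k f (Sigma3P2d4F5Specimen.constantCoeff_f k f hf) v hv

/-- (H2) the vertex is NOT regular: `f′(0) = 0`, `∇f′(0) = 0`. [cite: Hartshorne1977, I Thm. 5.1] -/
theorem vertex_not_mem_regularLocus [CharP k 2] (f : MvPolynomial (Fin 5) k) (hf : f = X 4 ^ 2 + X 0 ^ 2 * X 4 + X 0 ^ 5 + X 0 ^ 6 + X 1 ^ 5 + X 2 ^ 5 + X 3 ^ 5)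
    (v : Spec (.of (MvPolynomial (Fin 5) k ⧸ Ideal.span {f})))
    (hv : v.asIdeal = Ideal.span (Set.range fun j : Fin 5 => Ideal.Quotient.mk (Ideal.span {f}) (X j))) :
    v ∉ Scheme.regularLocus (Spec (.of (MvPolynomial (Fin 5) k ⧸ Ideal.span {f}))) := by
  classical
  refine not_mem_regularLocus_Spec_of_not_isRegularLocalRing v ?_
  refine not_isRegularLocalRing_localization_of_pderiv_eval_eq_zero (0 : Fin 5 → k) (Sigma3P2d4F5Specimen.prime_f k f hf).ne_zero ?_ ?_ v.asIdeal ?_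
  · rw [MvPolynomial.eval_zero]
    exact Sigma3P2d4F5Specimen.constantCoeff_f k f hf
  · intro i
    by_cases hi4 : i = 4
    · subst hi4
      rw [Sigma3P2d4F5Specimen.pderiv_four_f k f hf, map_pow, MvPolynomial.eval_X, Pi.zero_apply, zero_pow (by norm_num)]
    by_cases hi0 : i = 0
    · subst hi0
      rw [Sigma3P2d4F5Specimen.pderiv_zero_f k f hf, map_pow, MvPolynomial.eval_X, Pi.zero_apply, zero_pow (by norm_num)]
    · have hi : i = 1 ∨ i = 2 ∨ i = 3 := by fin_cases i <;> simp_all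
      rw [Sigma3P2d4F5Specimen.pderiv_quint_f k f hf i hi, map_pow, MvPolynomial.eval_X, Pi.zero_apply, zero_pow (by norm_num)]
  · rw [hv, DoublePointFermatCubicGerm.comap_origin k f (Sigma3P2d4F5Specimen.constantCoeff_f k f hf), MvPolynomial.eval_zero, Fedder.span_range_X_eq_ker]

/-- (H3) `dim 𝒪_{X,v} = 4`. [cite: Matsumura1987, Thm. 13.5] -/
theorem ringKrullDim_stalk_vertex [CharP k 2] (f : MvPolynomial (Fin 5) k) (hf : f = X 4 ^ 2 + X 0 ^ 2 * X 4 + X 0 ^ 5 + X 0 ^ 6 + X 1 ^ 5 + X 2 ^ 5 + X 3 ^ 5)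
    (v : Spec (.of (MvPolynomial (Fin 5) k ⧸ Ideal.span {f})))
    (hv : v.asIdeal = Ideal.span (Set.range fun j : Fin 5 => Ideal.Quotient.mk (Ideal.span {f}) (X j))) :
    ringKrullDim ((Spec (.of (MvPolynomial (Fin 5) k ⧸ Ideal.span {f}))).presheaf.stalk v) = (4 : ℕ) := by
  haveI : v.asIdeal.IsMaximal := by
    rw [hv]
    exact DoublePointFermatCubicGerm.isMaximal_origin k f (Sigma3P2d4F5Specimen.constantCoeff_f k f hf)
  rw [ringKrullDim_stalk_Spec_eq]
  exact HypersurfaceLocalDim.stub_hypersurfaceLocalDim k 4 f (Sigma3P2d4F5Specimen.prime_f k f hf).ne_zero v.asIdeal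

/-- `X` is regular at every point other than the vertex (the vertex is an ISOLATED singular point). [cite: Hartshorne1977, I Thm. 5.1] -/
theorem regular_of_ne_vertex [CharP k 2] (f : MvPolynomial (Fin 5) k) (hf : f = X 4 ^ 2 + X 0 ^ 2 * X 4 + X 0 ^ 5 + X 0 ^ 6 + X 1 ^ 5 + X 2 ^ 5 + X 3 ^ 5)
    (v : Spec (.of (MvPolynomial (Fin 5) k ⧸ Ideal.span {f})))
    (hv : v.asIdeal = Ideal.span (Set.range fun j : Fin 5 => Ideal.Quotient.mk (Ideal.span {f}) (X j))) :
    ∀ y : Spec (.of (MvPolynomial (Fin 5) k ⧸ Ideal.span {f})), y ⤳ v → y ≠ v →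
      y ∈ Scheme.regularLocus (Spec (.of (MvPolynomial (Fin 5) k ⧸ Ideal.span {f}))) := by
  intro y hy hne
  refine FermatCubicConeGerm.mem_regularLocus_Spec_of_isRegularLocalRing y (Sigma3P2d4F5Specimen.regular_off_vertex k f hf y.asIdeal fun hle => hne ?_)
  have h2 : y.asIdeal ≤ v.asIdeal := (PrimeSpectrum.le_iff_specializes y v).mpr hy
  exact PrimeSpectrum.ext (le_antisymm h2 (hv ▸ hle))

/-- (H4) ISOLATED: `Spec 𝒪_{X,v}` is regular off its closed point. [cite: Temkin2008, §2.1] -/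
theorem regular_off_closedPoint_vertex [CharP k 2] (f : MvPolynomial (Fin 5) k) (hf : f = X 4 ^ 2 + X 0 ^ 2 * X 4 + X 0 ^ 5 + X 0 ^ 6 + X 1 ^ 5 + X 2 ^ 5 + X 3 ^ 5)
    (v : Spec (.of (MvPolynomial (Fin 5) k ⧸ Ideal.span {f})))
    (hv : v.asIdeal = Ideal.span (Set.range fun j : Fin 5 => Ideal.Quotient.mk (Ideal.span {f}) (X j))) :
    ∀ s : Spec ((Spec (.of (MvPolynomial (Fin 5) k ⧸ Ideal.span {f}))).presheaf.stalk v),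
      s ≠ closedPoint _ → s ∈ Scheme.regularLocus (Spec ((Spec (.of (MvPolynomial (Fin 5) k ⧸ Ideal.span {f}))).presheaf.stalk v)) :=
  regularLocus_Spec_stalk_of_isolated v (regular_of_ne_vertex k f hf v hv)

/-- (H5) the CM-clause at every point of `Spec 𝒪_{X,v}`. [cite: Matsumura1987, Thm. 17.4 and Thm. 17.8] -/
theorem cmCl_Spec_stalk_vertex [CharP k 2] (f : MvPolynomial (Fin 5) k) (hf : f = X 4 ^ 2 + X 0 ^ 2 * X 4 + X 0 ^ 5 + X 0 ^ 6 + X 1 ^ 5 + X 2 ^ 5 + X 3 ^ 5)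
    (v : Spec (.of (MvPolynomial (Fin 5) k ⧸ Ideal.span {f})))
    (hv : v.asIdeal = Ideal.span (Set.range fun j : Fin 5 => Ideal.Quotient.mk (Ideal.span {f}) (X j))) :
    ∀ s : Spec ((Spec (.of (MvPolynomial (Fin 5) k ⧸ Ideal.span {f}))).presheaf.stalk v),
      CMCl ((Spec ((Spec (.of (MvPolynomial (Fin 5) k ⧸ Ideal.span {f}))).presheaf.stalk v)).presheaf.stalk s) :=
  cmCl_Spec_stalk_of_isolated v (cmCl_stalk_Spec_of_cmCl_localization v
    (DoublePointFermatCubicGerm.cmCl_localization_hypersurface k f (Sigma3P2d4F5Specimen.prime_f k f hf).ne_zero v)) (regular_of_ne_vertex k f hf v hv)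

/-! ## §1 The strict transforms of the point blow-up -/

/-- ★ **The chart identities** `θᵢ f′ = Xᵢ² · gᵢ` for `θᵢ : Xⱼ ↦ XⱼXᵢ (j ≠ i), Xᵢ ↦ Xᵢ`. [folklore] -/
theorem theta (f : MvPolynomial (Fin 5) k) (hf : f = X 4 ^ 2 + X 0 ^ 2 * X 4 + X 0 ^ 5 + X 0 ^ 6 + X 1 ^ 5 + X 2 ^ 5 + X 3 ^ 5) :
    ∀ i : Fin 5, aeval (fun j : Fin 5 => if j = i then (X i : MvPolynomial (Fin 5) k) else X j * X i) f =
      X i ^ ((fun _ : Fin 5 => 2) i) * (![X 4 ^ 2 + X 0 * X 4 + X 0 ^ 3 + X 0 ^ 4 + X 0 ^ 3 * X 1 ^ 5 + X 0 ^ 3 * X 2 ^ 5 + X 0 ^ 3 * X 3 ^ 5,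
        X 4 ^ 2 + X 0 ^ 2 * X 1 * X 4 + X 0 ^ 5 * X 1 ^ 3 + X 0 ^ 6 * X 1 ^ 4 + X 1 ^ 3 + X 1 ^ 3 * X 2 ^ 5 + X 1 ^ 3 * X 3 ^ 5,
        X 4 ^ 2 + X 0 ^ 2 * X 2 * X 4 + X 0 ^ 5 * X 2 ^ 3 + X 0 ^ 6 * X 2 ^ 4 + X 2 ^ 3 * X 1 ^ 5 + X 2 ^ 3 + X 2 ^ 3 * X 3 ^ 5,
        X 4 ^ 2 + X 0 ^ 2 * X 3 * X 4 + X 0 ^ 5 * X 3 ^ 3 + X 0 ^ 6 * X 3 ^ 4 + X 3 ^ 3 * X 1 ^ 5 + X 3 ^ 3 * X 2 ^ 5 + X 3 ^ 3,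
        1 + X 0 ^ 2 * X 4 + X 0 ^ 5 * X 4 ^ 3 + X 0 ^ 6 * X 4 ^ 4 + X 4 ^ 3 * X 1 ^ 5 + X 4 ^ 3 * X 2 ^ 5 + X 4 ^ 3 * X 3 ^ 5] : Fin 5 → MvPolynomial (Fin 5) k) i := by
  intro i
  subst hf
  fin_cases i <;> simp <;> ring

/-- `gᵢ ∉ (Xᵢ)` for every `i`: evaluate at `e_z` (`gᵢ = 1` there, `i ≤ 3`) resp. at `0` (`g_z(0) = 1`). [folklore] -/
theorem g_not_mem_span_X :
    ∀ i : Fin 5, (![X 4 ^ 2 + X 0 * X 4 + X 0 ^ 3 + X 0 ^ 4 + X 0 ^ 3 * X 1 ^ 5 + X 0 ^ 3 * X 2 ^ 5 + X 0 ^ 3 * X 3 ^ 5,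
        X 4 ^ 2 + X 0 ^ 2 * X 1 * X 4 + X 0 ^ 5 * X 1 ^ 3 + X 0 ^ 6 * X 1 ^ 4 + X 1 ^ 3 + X 1 ^ 3 * X 2 ^ 5 + X 1 ^ 3 * X 3 ^ 5,
        X 4 ^ 2 + X 0 ^ 2 * X 2 * X 4 + X 0 ^ 5 * X 2 ^ 3 + X 0 ^ 6 * X 2 ^ 4 + X 2 ^ 3 * X 1 ^ 5 + X 2 ^ 3 + X 2 ^ 3 * X 3 ^ 5,
        X 4 ^ 2 + X 0 ^ 2 * X 3 * X 4 + X 0 ^ 5 * X 3 ^ 3 + X 0 ^ 6 * X 3 ^ 4 + X 3 ^ 3 * X 1 ^ 5 + X 3 ^ 3 * X 2 ^ 5 + X 3 ^ 3,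
        1 + X 0 ^ 2 * X 4 + X 0 ^ 5 * X 4 ^ 3 + X 0 ^ 6 * X 4 ^ 4 + X 4 ^ 3 * X 1 ^ 5 + X 4 ^ 3 * X 2 ^ 5 + X 4 ^ 3 * X 3 ^ 5] : Fin 5 → MvPolynomial (Fin 5) k) i ∉
      Ideal.span {(X i : MvPolynomial (Fin 5) k)} := by
  intro i h
  rw [Ideal.mem_span_singleton] at h
  obtain ⟨c, hc⟩ := h
  fin_cases i
  · have := congrArg (MvPolynomial.eval (Pi.single 4 1 : Fin 5 → k)) hc; simp at this
  · have := congrArg (MvPolynomial.eval (Pi.single 4 1 : Fin 5 → k)) hc; simp at this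
  · have := congrArg (MvPolynomial.eval (Pi.single 4 1 : Fin 5 → k)) hc; simp at this
  · have := congrArg (MvPolynomial.eval (Pi.single 4 1 : Fin 5 → k)) hc; simp at this
  · have := congrArg (MvPolynomial.eval (0 : Fin 5 → k)) hc; simp at this

/-- `g_y(0) = 0`: the origin of the `y`-chart lies on the strict transform. [folklore] -/
theorem constantCoeff_g_one : constantCoeff ((![X 4 ^ 2 + X 0 * X 4 + X 0 ^ 3 + X 0 ^ 4 + X 0 ^ 3 * X 1 ^ 5 + X 0 ^ 3 * X 2 ^ 5 + X 0 ^ 3 * X 3 ^ 5,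
        X 4 ^ 2 + X 0 ^ 2 * X 1 * X 4 + X 0 ^ 5 * X 1 ^ 3 + X 0 ^ 6 * X 1 ^ 4 + X 1 ^ 3 + X 1 ^ 3 * X 2 ^ 5 + X 1 ^ 3 * X 3 ^ 5,
        X 4 ^ 2 + X 0 ^ 2 * X 2 * X 4 + X 0 ^ 5 * X 2 ^ 3 + X 0 ^ 6 * X 2 ^ 4 + X 2 ^ 3 * X 1 ^ 5 + X 2 ^ 3 + X 2 ^ 3 * X 3 ^ 5,
        X 4 ^ 2 + X 0 ^ 2 * X 3 * X 4 + X 0 ^ 5 * X 3 ^ 3 + X 0 ^ 6 * X 3 ^ 4 + X 3 ^ 3 * X 1 ^ 5 + X 3 ^ 3 * X 2 ^ 5 + X 3 ^ 3,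
        1 + X 0 ^ 2 * X 4 + X 0 ^ 5 * X 4 ^ 3 + X 0 ^ 6 * X 4 ^ 4 + X 4 ^ 3 * X 1 ^ 5 + X 4 ^ 3 * X 2 ^ 5 + X 4 ^ 3 * X 3 ^ 5] : Fin 5 → MvPolynomial (Fin 5) k) 1) = 0 := by
  simp [constantCoeff_X]

/-- ★ **THE FEDDER CERTIFICATE OF THE `y`-CHART** (`p = 2`): `g_y = z² + x²yz + x⁵y³ + x⁶y⁴ + y³(1 + u⁵ + t⁵) ∈ 𝔪^{[2]} = (x², y², u², t², z²)` termwise, so the origin of the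
`y`-chart of the point blow-up is NOT F-pure (the `x`-chart origin IS F-pure here: `g_x ∋ xz`). [OURS · certificate; cite: Fedder1983, Prop. 1.7] -/
theorem g_one_mem_frobeniusPower :
    (X 4 ^ 2 + X 0 ^ 2 * X 1 * X 4 + X 0 ^ 5 * X 1 ^ 3 + X 0 ^ 6 * X 1 ^ 4 + X 1 ^ 3 + X 1 ^ 3 * X 2 ^ 5 + X 1 ^ 3 * X 3 ^ 5 : MvPolynomial (Fin 5) k) ^ (2 - 1) ∈
      Ideal.span (Set.range fun i : Fin 5 => (X i : MvPolynomial (Fin 5) k) ^ 2) := by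
  have hX : ∀ i : Fin 5, (X i : MvPolynomial (Fin 5) k) ^ 2 ∈ Ideal.span (Set.range fun i : Fin 5 => (X i : MvPolynomial (Fin 5) k) ^ 2) :=
    fun i => Ideal.subset_span ⟨i, rfl⟩
  have hfac : (X 4 ^ 2 + X 0 ^ 2 * X 1 * X 4 + X 0 ^ 5 * X 1 ^ 3 + X 0 ^ 6 * X 1 ^ 4 + X 1 ^ 3 + X 1 ^ 3 * X 2 ^ 5 + X 1 ^ 3 * X 3 ^ 5 : MvPolynomial (Fin 5) k) ^ (2 - 1) =
      X 4 ^ 2 + X 0 ^ 2 * (X 1 * X 4 + X 0 ^ 3 * X 1 ^ 3 + X 0 ^ 4 * X 1 ^ 4) + X 1 ^ 2 * (X 1 + X 1 * X 2 ^ 5 + X 1 * X 3 ^ 5) := by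
    ring
  rw [hfac]
  refine Ideal.add_mem _ (Ideal.add_mem _ (hX 4) ?_) ?_
  · exact Ideal.mul_mem_right _ _ (hX 0)
  · exact Ideal.mul_mem_right _ _ (hX 1)

/-! ## §2 ★ For EVERY blowing up along the point floor: legal -/

/-- ★ **THE POINT FLOOR OF `V(f′)` IS A LEGAL INPUT** (char 2): for every blowing up `g : S′ → Spec 𝒪_{X,v}` along `I = 𝔪̃|_{Spec 𝒪_{X,v}}`: `I ≠ ⊥`, `Supp I ⊆ (Reg)ᶜ`, `S′` regular
off the closed fibre, CM everywhere — ONE application of ✓ `PointFloorLegalOfIsolated.pointFloor_input_legal`. [folklore assembly; cite: GortzWedhorn2020, Prop. 13.91 (2)] [cite: Temkin2008, §2.1] -/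
theorem pointFloor_sigma3F5_input_legal [CharP k 2] (f : MvPolynomial (Fin 5) k) (hf : f = X 4 ^ 2 + X 0 ^ 2 * X 4 + X 0 ^ 5 + X 0 ^ 6 + X 1 ^ 5 + X 2 ^ 5 + X 3 ^ 5)
    (v : Spec (.of (MvPolynomial (Fin 5) k ⧸ Ideal.span {f})))
    (hv : v.asIdeal = Ideal.span (Set.range (fun j : Fin 5 => Ideal.Quotient.mk (Ideal.span {f}) (X j))))
    (S' : Scheme.{0}) (g : S' ⟶ Spec ((Spec (.of (MvPolynomial (Fin 5) k ⧸ Ideal.span {f}))).presheaf.stalk v))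
    (hg : IsBlowup g ((affineBlowup.idealSheaf (Ideal.span (Set.range (fun j : Fin 5 => Ideal.Quotient.mk (Ideal.span {f}) (X j))))).comap ((Spec (.of (MvPolynomial (Fin 5) k ⧸ Ideal.span {f}))).fromSpecStalk v))) :
    ((affineBlowup.idealSheaf (Ideal.span (Set.range (fun j : Fin 5 => Ideal.Quotient.mk (Ideal.span {f}) (X j))))).comap ((Spec (.of (MvPolynomial (Fin 5) k ⧸ Ideal.span {f}))).fromSpecStalk v)) ≠ ⊥ ∧
    (((((affineBlowup.idealSheaf (Ideal.span (Set.range (fun j : Fin 5 => Ideal.Quotient.mk (Ideal.span {f}) (X j))))).comap ((Spec (.of (MvPolynomial (Fin 5) k ⧸ Ideal.span {f}))).fromSpecStalk v))).support :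
        Set (Spec ((Spec (.of (MvPolynomial (Fin 5) k ⧸ Ideal.span {f}))).presheaf.stalk v))) ⊆ (Scheme.regularLocus (Spec ((Spec (.of (MvPolynomial (Fin 5) k ⧸ Ideal.span {f}))).presheaf.stalk v)))ᶜ) ∧
    (∀ s : S', g.base s ≠ closedPoint ((Spec (.of (MvPolynomial (Fin 5) k ⧸ Ideal.span {f}))).presheaf.stalk v) → s ∈ Scheme.regularLocus S') ∧
    (∀ s : S', CMCl (S'.presheaf.stalk s)) :=
  PointFloorLegalOfIsolated.pointFloor_input_legal k f (Sigma3P2d4F5Specimen.prime_f k f hf) (by norm_num) (fun _ : Fin 5 => 2) _ (theta k f hf)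
    (Sigma3P2d4F5Specimen.f_not_mem_span_X k f hf) (g_not_mem_span_X k) v hv (vertex_not_mem_regularLocus k f hf v hv)
    (regular_of_ne_vertex k f hf v hv) S' g hg

/-! ## §3 ★ For EVERY blowing up along the point floor: NOT FULL -/

/-- ★ **THE POINT FLOOR OF `V(f′)` IS NOT FULL** (char 2): for every blowing up `g : S′ → Spec 𝒪_{X,v}` along the point floor there is a point `s ∈ S′` over the closed point
whose local ring is NOT `FullCl 2` (the origin of the `y`-chart, Fedder certificate `g_one_mem_frobeniusPower`) — ONE application of ✓ `PointFloorNotFullOfFedder.pointFloor_not_full`.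
[OURS · negative certificate; cite: Fedder1983, Thm. 1.12] -/
theorem pointFloor_sigma3F5_not_full [CharP k 2] (f : MvPolynomial (Fin 5) k) (hf : f = X 4 ^ 2 + X 0 ^ 2 * X 4 + X 0 ^ 5 + X 0 ^ 6 + X 1 ^ 5 + X 2 ^ 5 + X 3 ^ 5)
    (v : Spec (.of (MvPolynomial (Fin 5) k ⧸ Ideal.span {f})))
    (hv : v.asIdeal = Ideal.span (Set.range (fun j : Fin 5 => Ideal.Quotient.mk (Ideal.span {f}) (X j))))
    (S' : Scheme.{0}) (g : S' ⟶ Spec ((Spec (.of (MvPolynomial (Fin 5) k ⧸ Ideal.span {f}))).presheaf.stalk v))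
    (hg : IsBlowup g ((affineBlowup.idealSheaf (Ideal.span (Set.range (fun j : Fin 5 => Ideal.Quotient.mk (Ideal.span {f}) (X j))))).comap ((Spec (.of (MvPolynomial (Fin 5) k ⧸ Ideal.span {f}))).fromSpecStalk v))) :
    ∃ s : S', g.base s = closedPoint ((Spec (.of (MvPolynomial (Fin 5) k ⧸ Ideal.span {f}))).presheaf.stalk v) ∧ ¬ FullCl 2 (S'.presheaf.stalk s) := by
  haveI : Fact (Nat.Prime 2) := ⟨Nat.prime_two⟩
  exact PointFloorNotFullOfFedder.pointFloor_not_full 2 k f (Sigma3P2d4F5Specimen.prime_f k f hf) (fun _ : Fin 5 => 2) _ (theta k f hf)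
    (Sigma3P2d4F5Specimen.f_not_mem_span_X k f hf) (g_not_mem_span_X k) (Sigma3P2d4F5Specimen.constantCoeff_f k f hf) 1 (constantCoeff_g_one k)
    (g_one_mem_frobeniusPower k) v hv S' g hg

end Summit.ResolutionOfSingularities.ResolutionOfSingularities.Theorems.FInjectiveMacaulayfication.Sigma3P2d4F5PointFloor

end
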